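import Mathlib
import HarnessLib
import Summits.Ventures.LatticeQCDFlow.Scoring.TranslationAverageTwoPoint
import Summits.Ventures.LatticeQCDFlow.Scoring.CloverDensityMeanZero

/-!
# The time-slab decomposition of the susceptibility on the periodic lattice: `Q = Σ_t Q_t`, `E[Q²] = Σ_{a,b} E[Q_a Q_b] = L · Σ_s E[Q_0 Q_s]`, and the slab correlator depends on the time separation only

HONEST FRAMING: exact (Metropolis-corrected) sampling algorithms for lattice gauge theory;
figures of merit are autocorrelation/cost numbers at stated couplings and volumes; no
continuum-physics claim.

Venture `LatticeQCDFlow` (cell pub-lqcd), sub-topic `Scoring`, FANOUT row 21 (`su3-base`: the susceptibility `⟨Q²⟩/V` of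
acceptance (c) is read on the periodic arms from the total charge and on the open-boundary arm from SLAB charges
`Q_t = Σ_{x : x₀ = t} q_x`; the time-slice correlator `C(s) = ⟨Q_t Q_{t+s}⟩` is the common currency of the two readings).
NEW WORK of the cell, def-free, over row 21's `Scoring/TranslationAverageTwoPoint` (site fields `f_x(τ_v U) = f_{x−v}(U)` under a
translation-invariant law; the measured charge density `q_x = P_x ∘ RK3^m` is one: `rk3CloverDensity_torusConfigShift`; arm E2's
step laws and the Wilson measure are translation invariant) and row 16's `Scoring/CloverDensityMeanZero`
(`cloverPseudoscalar_torusConfigShift`: the bare clover density is one).  Nothing is cited as a fact; no number.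

## What is here (torus `(ℤ/L)^d`, time = coordinate `0`, any measurable `G`, a law `μ` with `μ ∘ τ_v⁻¹ = μ` for all `v`)

* §1 SLAB SUMS of a site field, `S_t(U) = Σ_{x : x₀ = t} f_x(U)`: `sum_siteField_eq_sum_slab` (`Σ_x f_x = Σ_t S_t`, the fibres of
  `x ↦ x₀`), `slabSum_torusConfigShift` (`S_t(τ_v U) = S_{t − v₀}(U)`), **`integral_slabSum_mul_slabSum_translate`**
  (`E[S_a S_b] = E[S_{a+u} S_{b+u}]`: the slab correlator depends on the separation only), `integral_slabSum_mul_slabSum_swap`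
  (`E[S_0 S_s] = E[S_0 S_{−s}]`).
* §2 **`integral_sq_sum_siteField_eq_sum_slab`** — `E[(Σ_x f_x)²] = Σ_a Σ_b E[S_a S_b]`, and
  **`integral_sq_sum_siteField_eq_card_mul_sum_slab`** — `= L · Σ_s E[S_0 S_s]`: the susceptibility numerator is `L` times the
  summed slab correlator from the slice `0`.
* §3 the instances: **`wilson_integral_sq_cloverCharge_eq_card_mul_sum_slab`** (the bare clover charge under the Wilson measure,
  any compact `G`, continuous `ρ`, every `β`) and **`wilson_integral_sq_rk3CloverCharge_eq_card_mul_sum_slab`** (the MEASURED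
  charge `Σ_x P_x ∘ RK3_{ε'}^m` of `SU(n)` under the Wilson measure): `E[Q_m²] = L · Σ_s E[Q_{m,0} Q_{m,s}]`.
NOT CLAIMED: any sign or decay of the slab correlator (the reflection-positivity sign is row 21's
`Exactness/ChargeSlabCorrelatorRP`); open boundaries (no time translations there — `Exactness/OpenBoundaryProfile`); numbers.
-/

noncomputable section

namespace Summit.Ventures.LatticeQCDFlow.Scoring

open MeasureTheory
open Literature.MathematicalPhysics.QuantumFieldTheory
open Literature.MathematicalPhysics.QuantumLattice (fundamentalRep continuous_fundamentalRep cloverPseudoscalar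
  continuous_cloverPseudoscalar)

/-! ## §1 Slab sums of a site field under a translation-invariant law -/

section Generic

variable {d L : ℕ} [NeZero d] [NeZero L] {G : Type*} [MeasurableSpace G]

/-- **`Σ_x f_x = Σ_t S_t`**: the lattice sum is the sum of its time-slab sums (the fibres of `x ↦ x₀`). -/
theorem sum_siteField_eq_sum_slab (F : Site d L → ℝ) :
    ∑ x, F x = ∑ t : ZMod L, ∑ x ∈ Finset.univ.filter (fun x : Site d L => x 0 = t), F x := by
  rw [← Finset.sum_fiberwise_of_maps_to (g := fun x : Site d L => x 0) (t := Finset.univ) (fun x _ => Finset.mem_univ _)]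

/-- **`S_t(τ_v U) = S_{t − v₀}(U)`**: the slab sum of a translation-covariant site field read on a translated configuration is
the slab sum of the shifted slice. -/
theorem slabSum_torusConfigShift (f : Site d L → GaugeConfig d L G → ℝ)
    (hf : ∀ v x U, f x (TorusTranslation.torusConfigShift v U) = f (x - v) U) (v : Site d L) (t : ZMod L)
    (U : GaugeConfig d L G) :
    ∑ x ∈ Finset.univ.filter (fun x : Site d L => x 0 = t), f x (TorusTranslation.torusConfigShift v U) =
      ∑ x ∈ Finset.univ.filter (fun x : Site d L => x 0 = t - v 0), f x U := by
  simp only [hf]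
  refine Finset.sum_nbij' (fun x => x - v) (fun x => x + v) (fun x hx => ?_) (fun x hx => ?_) (fun x _ => by simp)
    (fun x _ => by simp) (fun x _ => rfl)
  · simp only [Finset.mem_filter, Finset.mem_univ, true_and, Pi.sub_apply] at hx ⊢
    rw [hx]
  · simp only [Finset.mem_filter, Finset.mem_univ, true_and, Pi.add_apply] at hx ⊢
    rw [hx, sub_add_cancel]

variable {μ : Measure (GaugeConfig d L G)}

/-- **`E[(Σ_x f_x)²] = Σ_a Σ_b E[S_a S_b]`** (all slab products integrable; no invariance needed). -/
theorem integral_sq_sum_siteField_eq_sum_slab (f : Site d L → GaugeConfig d L G → ℝ)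
    (hint : ∀ a b : ZMod L, Integrable (fun U => (∑ x ∈ Finset.univ.filter (fun x : Site d L => x 0 = a), f x U) *
      (∑ x ∈ Finset.univ.filter (fun x : Site d L => x 0 = b), f x U)) μ) :
    ∫ U, (∑ x, f x U) ^ 2 ∂μ =
      ∑ a : ZMod L, ∑ b : ZMod L, ∫ U, (∑ x ∈ Finset.univ.filter (fun x : Site d L => x 0 = a), f x U) *
        (∑ x ∈ Finset.univ.filter (fun x : Site d L => x 0 = b), f x U) ∂μ := by
  have hexp : ∀ U : GaugeConfig d L G, (∑ x, f x U) ^ 2 =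
      ∑ a : ZMod L, ∑ b : ZMod L, (∑ x ∈ Finset.univ.filter (fun x : Site d L => x 0 = a), f x U) *
        (∑ x ∈ Finset.univ.filter (fun x : Site d L => x 0 = b), f x U) := fun U => by
    rw [sq, sum_siteField_eq_sum_slab (fun x => f x U), Finset.sum_mul_sum]
  simp only [hexp]
  rw [integral_finsetSum _ fun a _ => integrable_finsetSum _ fun b _ => hint a b]
  exact Finset.sum_congr rfl fun a _ => integral_finsetSum _ fun b _ => hint a b

variable (hμ : ∀ v : Site d L, μ.map (TorusTranslation.torusConfigShift v) = μ)

include hμ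

/-- **THE SLAB CORRELATOR DEPENDS ON THE SEPARATION ONLY: `E[S_a S_b] = E[S_{a+u} S_{b+u}]`** for every `u`. -/
theorem integral_slabSum_mul_slabSum_translate (f : Site d L → GaugeConfig d L G → ℝ)
    (hf : ∀ v x U, f x (TorusTranslation.torusConfigShift v U) = f (x - v) U) (a b u : ZMod L) :
    ∫ U, (∑ x ∈ Finset.univ.filter (fun x : Site d L => x 0 = a), f x U) *
        (∑ x ∈ Finset.univ.filter (fun x : Site d L => x 0 = b), f x U) ∂μ =
      ∫ U, (∑ x ∈ Finset.univ.filter (fun x : Site d L => x 0 = a + u), f x U) *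
        (∑ x ∈ Finset.univ.filter (fun x : Site d L => x 0 = b + u), f x U) ∂μ := by
  -- translate by `v = −u e₀`: `S_{a+u}(τ_v U) = S_{a+u−v₀}(U) = S_a(U)`… read backwards
  have h := integral_comp_torusConfigShift_of_invariant hμ (Pi.single (0 : Fin d) u)
    (fun U => (∑ x ∈ Finset.univ.filter (fun x : Site d L => x 0 = a + u), f x U) *
      (∑ x ∈ Finset.univ.filter (fun x : Site d L => x 0 = b + u), f x U))
  simp only [slabSum_torusConfigShift f hf, Pi.single_eq_same, add_sub_cancel_right] at h
  exact h

/-- `E[S_0 S_s] = E[S_0 S_{−s}]` (translate by `−s` and commute the product). -/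
theorem integral_slabSum_mul_slabSum_swap (f : Site d L → GaugeConfig d L G → ℝ)
    (hf : ∀ v x U, f x (TorusTranslation.torusConfigShift v U) = f (x - v) U) (s : ZMod L) :
    ∫ U, (∑ x ∈ Finset.univ.filter (fun x : Site d L => x 0 = 0), f x U) *
        (∑ x ∈ Finset.univ.filter (fun x : Site d L => x 0 = s), f x U) ∂μ =
      ∫ U, (∑ x ∈ Finset.univ.filter (fun x : Site d L => x 0 = 0), f x U) *
        (∑ x ∈ Finset.univ.filter (fun x : Site d L => x 0 = -s), f x U) ∂μ := by
  rw [integral_slabSum_mul_slabSum_translate hμ f hf 0 s (-s)]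
  simp only [zero_add, add_neg_cancel, mul_comm]

/-! ## §2 The second moment of the lattice sum in slabs -/

/-- **`E[(Σ_x f_x)²] = L · Σ_s E[S_0 S_s]`**: by translation invariance every row of the slab–slab matrix is the row of the
slice `0`. -/
theorem integral_sq_sum_siteField_eq_card_mul_sum_slab (f : Site d L → GaugeConfig d L G → ℝ)
    (hf : ∀ v x U, f x (TorusTranslation.torusConfigShift v U) = f (x - v) U)
    (hint : ∀ a b : ZMod L, Integrable (fun U => (∑ x ∈ Finset.univ.filter (fun x : Site d L => x 0 = a), f x U) *
      (∑ x ∈ Finset.univ.filter (fun x : Site d L => x 0 = b), f x U)) μ) :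
    ∫ U, (∑ x, f x U) ^ 2 ∂μ =
      (L : ℝ) * ∑ s : ZMod L, ∫ U, (∑ x ∈ Finset.univ.filter (fun x : Site d L => x 0 = 0), f x U) *
        (∑ x ∈ Finset.univ.filter (fun x : Site d L => x 0 = s), f x U) ∂μ := by
  rw [integral_sq_sum_siteField_eq_sum_slab f hint]
  have hrow : ∀ a : ZMod L, ∑ b : ZMod L, ∫ U, (∑ x ∈ Finset.univ.filter (fun x : Site d L => x 0 = a), f x U) *
        (∑ x ∈ Finset.univ.filter (fun x : Site d L => x 0 = b), f x U) ∂μ =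
      ∑ s : ZMod L, ∫ U, (∑ x ∈ Finset.univ.filter (fun x : Site d L => x 0 = 0), f x U) *
        (∑ x ∈ Finset.univ.filter (fun x : Site d L => x 0 = s), f x U) ∂μ := by
    intro a
    refine Fintype.sum_equiv (Equiv.subRight a) _ _ fun b => ?_
    rw [integral_slabSum_mul_slabSum_translate hμ f hf a b (-a)]
    simp only [add_neg_cancel, Equiv.subRight_apply, sub_eq_add_neg]
  simp only [hrow, Finset.sum_const, Finset.card_univ, ZMod.card, nsmul_eq_mul]

end Generic

/-! ## §3 The instances: the bare clover charge and the measured charge under the Wilson measure -/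

section Wilson

variable {L N : ℕ} [NeZero L] {G : Type*} [Group G] [TopologicalSpace G] [IsTopologicalGroup G] [CompactSpace G]
  [MeasurableSpace G] [BorelSpace G] [SecondCountableTopology G] (ρ : G →* Matrix (Fin N) (Fin N) ℂ)

/-- **THE BARE CLOVER CHARGE: `E_β[(Σ_x P_x)²] = L · Σ_s E_β[Q_0 Q_s]`** with `Q_t = Σ_{x : x₀ = t} P_x`, for every compact `G`,
continuous `ρ`, every real `β`, on `(ℤ/L)⁴`. -/
theorem wilson_integral_sq_cloverCharge_eq_card_mul_sum_slab (hρ : Continuous ρ) (β : ℝ) :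
    ∫ U, (∑ x : Site 4 L, cloverPseudoscalar ρ x U) ^ 2 ∂(wilsonMeasure ρ β) =
      (L : ℝ) * ∑ s : ZMod L, ∫ U, (∑ x ∈ Finset.univ.filter (fun x : Site 4 L => x 0 = 0), cloverPseudoscalar ρ x U) *
        (∑ x ∈ Finset.univ.filter (fun x : Site 4 L => x 0 = s), cloverPseudoscalar ρ x U) ∂(wilsonMeasure ρ β) := by
  haveI := isProbabilityMeasure_wilsonMeasure (d := 4) (L := L) ρ hρ β
  refine integral_sq_sum_siteField_eq_card_mul_sum_slab (fun v => wilsonMeasure_map_torusConfigShift ρ β v)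
    (fun x U => cloverPseudoscalar ρ x U) (fun v x U => cloverPseudoscalar_torusConfigShift ρ v x U) fun a b => ?_
  have hc : Continuous fun U : GaugeConfig 4 L G =>
      (∑ x ∈ Finset.univ.filter (fun x : Site 4 L => x 0 = a), cloverPseudoscalar ρ x U) *
        (∑ x ∈ Finset.univ.filter (fun x : Site 4 L => x 0 = b), cloverPseudoscalar ρ x U) :=
    (continuous_finsetSum _ fun x _ => continuous_cloverPseudoscalar ρ hρ x).mul
      (continuous_finsetSum _ fun x _ => continuous_cloverPseudoscalar ρ hρ x)
  obtain ⟨C, hC⟩ := (isCompact_univ.image (continuous_abs.comp hc)).isBounded.bddAbove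
  exact (integrable_const (max C 0)).mono' hc.measurable.aestronglyMeasurable
    (ae_of_all _ fun U => by
      rw [Real.norm_eq_abs]
      exact (hC ⟨U, Set.mem_univ _, rfl⟩).trans (le_max_left _ _))

end Wilson

section Measured

variable {L n : ℕ} [NeZero L]

/-- **THE MEASURED CHARGE: `E_β[Q_m²] = L · Σ_s E_β[Q_{m,0} Q_{m,s}]`** for `Q_m = Σ_x P_x ∘ RK3_{ε'}^m` (the clover charge after
`m` RK3 flow steps, row 21's measurement) of `SU(n)` under the Wilson measure, every `β'`, `ε'`, `m`. -/
theorem wilson_integral_sq_rk3CloverCharge_eq_card_mul_sum_slab (β' ε' : ℝ) (m : ℕ) :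
    ∫ U, (∑ x : Site 4 L, cloverPseudoscalar (fundamentalRep (Fin n)) x ((wilsonFlowRK3 ε')^[m] U)) ^ 2
        ∂(wilsonMeasure (d := 4) (L := L) (fundamentalRep (Fin n)) β') =
      (L : ℝ) * ∑ s : ZMod L, ∫ U,
        (∑ x ∈ Finset.univ.filter (fun x : Site 4 L => x 0 = 0),
            cloverPseudoscalar (fundamentalRep (Fin n)) x ((wilsonFlowRK3 ε')^[m] U)) *
          (∑ x ∈ Finset.univ.filter (fun x : Site 4 L => x 0 = s),
            cloverPseudoscalar (fundamentalRep (Fin n)) x ((wilsonFlowRK3 ε')^[m] U))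
          ∂(wilsonMeasure (d := 4) (L := L) (fundamentalRep (Fin n)) β') := by
  haveI := isProbabilityMeasure_wilsonMeasure (d := 4) (L := L) (G := Matrix.specialUnitaryGroup (Fin n) ℂ)
    (fundamentalRep (Fin n)) (continuous_fundamentalRep (Fin n)) β'
  refine integral_sq_sum_siteField_eq_card_mul_sum_slab
    (fun v => wilsonMeasure_map_torusConfigShift (fundamentalRep (Fin n)) β' v)
    (fun x U => cloverPseudoscalar (fundamentalRep (Fin n)) x ((wilsonFlowRK3 ε')^[m] U))
    (fun v x U => rk3CloverDensity_torusConfigShift ε' m v x U) fun a b => ?_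
  exact integrable_of_continuous_sunConfig
    ((continuous_finsetSum _ fun x _ => (continuous_cloverPseudoscalar _ (continuous_fundamentalRep (Fin n)) x).comp
        (continuous_iterate_wilsonFlowRK3 ε' m)).mul
      (continuous_finsetSum _ fun x _ => (continuous_cloverPseudoscalar _ (continuous_fundamentalRep (Fin n)) x).comp
        (continuous_iterate_wilsonFlowRK3 ε' m)))

end Measured

end Summit.Ventures.LatticeQCDFlow.Scoring
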